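import Mathlib
import Summits.Ventures.PercRepro2.CrossAPrimeThreeRoutesBlobMasses
import Summits.Ventures.PercRepro2.CrossAPrimeMixtureAlgebra

/-!
# The three-route blob class: a two-route core plus a free route `a₁–z–v` with a coin at `z`
(blind cell PercRepro2, p5 g36; S4 §2.4 (s) addendum 38 (4))

The marked routes `π₁ ∋ o`, `π₂ ∋ b` form a two-route core (hypotheses of the two-route theorem
on the support of the measure with the three gadget edges closed); the gadget is a vertex `z`
whose only edges are `e₁ = {a₁, z}`, `e₂ = {z, v}` and the coin `e₃ = {a₂, z}`.  Pinning the
three gadget edges writes every mass of `p` as a combination of the masses of eight pinned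
measures (`prob_pin_three`), and these are identified (`flip` lemmas: an edge at an ISOLATED
vertex may be flipped without changing any connection among the other vertices,
`conn_update_true_iff_of_isolated`):
* `(·,·,·) = (0,0,0), (0,0,1), (0,1,0), (1,0,0)`: the core law `m″` (the two-route law);
* `(0,1,1)`: the glued law `m^on` (`v ∈ K` surely on `Q`, route masses `0`);
* `(1,1,0)`: the `v ∉ K` law of the core with `a₁ ↔ v` sure (`m_v̄`; the events
  `{a₂ ↮ a₁, z, v} ∩ ·` are determined off `e₁, e₂`);
* `(1,·,1)`: `Q = ∅`.
So the masses of `p` are `A·m″ + G·m^on + B·m_v̄` with `A = (1 − ζ)(1 − a·r) + (1 − a)ζ(1 − r)`,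
`G = (1 − a)ζr`, `B = aζ(1 − r)` (`a = p e₁`, `ζ = p e₂`, `r = p e₃`), the constant
`C = π̃₁₂ + aζ(1 − π̃₁₂) ≤ π` (`const_le_pi_blob`), and
`CrossAPrimeMixtureAlgebra.mixture_nonneg` gives **`crossA'so_nonneg_of_threeRoutesBlob`**.
Own work; standard axioms.
-/


namespace Summit.Ventures.PercRepro2

open LeafRowPendantRootSO CrossAPrimeA2Route CrossAPrimeSupport CrossAPrimeTwoRoutes
  CrossAPrimeTwoRoutesSupp CrossAPrimeAvoidCrux CrossAPrimeFreeEdge CrossAPrimeMixtureAlgebra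
  CrossAPrimeIsolatedFlip CrossAPrimeThreeRoutesBlobMasses

namespace CrossAPrimeThreeRoutesBlob

section Main

variable {V : Type*} {E : Type*} [Fintype E] [DecidableEq E] [Fintype V] [DecidableEq V]
  {R : Type*} [Field R] [LinearOrder R] [IsStrictOrderedRing R]
variable {ends : E → Sym2 V}

/-- **The three-route blob class.**  A two-route core (`π₁ ∋ o`, `π₂ ∋ b`; hypotheses of the
two-route theorem on the support of the measure with the gadget edges closed) plus a vertex `z`
whose only edges are `e₁ = {a₁, z}`, `e₂ = {z, v}` and the coin `e₃ = {a₂, z}`: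
`0 ≤ crossA′so`.  The proof is the three-component mixture of S4 addendum 38 (4). -/
theorem crossA'so_nonneg_of_threeRoutesBlob (p : E → R) (hp : IsProbVec p)
    {π₁ π₂ τ₁ τ₂ : Finset E} {V₁ V₂ : Finset V} {o a₁ a₂ v b z : V} {e₁ e₂ e₃ : E}
    (h₁ : ends e₁ = s(a₁, z)) (h₂ : ends e₂ = s(z, v)) (h₃ : ends e₃ = s(a₂, z))
    (hz : ∀ e, z ∈ ends e → e = e₁ ∨ e = e₂ ∨ e = e₃)
    (hza₁ : a₁ ≠ z) (hza₂ : a₂ ≠ z) (hzo : o ≠ z) (hzb : b ≠ z) (hzv : v ≠ z)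
    (h₁₂ : e₁ ≠ e₂) (h₁₃ : e₁ ≠ e₃) (h₂₃ : e₂ ≠ e₃)
    (he₁₁ : e₁ ∉ π₁) (he₁₂ : e₁ ∉ π₂) (he₂₁ : e₂ ∉ π₁) (he₂₂ : e₂ ∉ π₂) (he₃₁ : e₃ ∉ π₁)
    (he₃₂ : e₃ ∉ π₂)
    (hd : Disjoint π₁ π₂)
    (hπ₁ : ∀ e ∈ π₁, ∀ x, x ∈ ends e → x = a₁ ∨ x ∈ V₁)
    (hπ₂ : ∀ e ∈ π₂, ∀ x, x ∈ ends e → x = a₁ ∨ x ∈ V₂)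
    (hconn₁ : ∀ ω ∈ allOpen π₁, ∀ x ∈ V₁, Conn ends ω a₁ x)
    (hconn₂ : ∀ ω ∈ allOpen π₂, ∀ x ∈ V₂, Conn ends ω a₁ x)
    (hv₁ : v ∈ V₁) (hv₂ : v ∈ V₂) (ho : o ∈ V₁) (hb : b ∈ V₂)
    (hroute : ∀ ω ∈ supp (Function.update (Function.update (Function.update p e₁ 0) e₂ 0) e₃ 0),
      ω ∈ avoidAll ends a₂ {a₁} →
        (ω ∈ connEvent ends a₁ v ↔ ω ∈ allOpen π₁ ∪ allOpen π₂))
    (hτ₁ : τ₁ ⊆ π₁) (hτ₂ : τ₂ ⊆ π₂)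
    (htail₁ : ∀ ω ∈ allOpen τ₁, Conn ends ω o v) (htail₂ : ∀ ω ∈ allOpen τ₂, Conn ends ω b v)
    (hsep₁ : ∀ ω ∈ supp (Function.update (Function.update (Function.update p e₁ 0) e₂ 0) e₃ 0),
      ω ∈ avoidAll ends a₂ {a₁} → ω ∈ connEvent ends a₂ o →
        Conn ends (forceOpen τ₁ ω) a₂ a₁ → ω ∈ allOpen π₂)
    (hsep₂ : ∀ ω ∈ supp (Function.update (Function.update (Function.update p e₁ 0) e₂ 0) e₃ 0),
      ω ∈ avoidAll ends a₂ {a₁} → ω ∈ connEvent ends a₂ b →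
        Conn ends (forceOpen τ₂ ω) a₂ a₁ → ω ∈ allOpen π₁) :
    0 ≤ crossA'so p ends o a₁ a₂ v b := by
  classical
  have hC := const_le_pi_blob p hp h₁ h₂ h₁₂ h₁₃ h₂₃ hd he₁₁ he₁₂ he₂₁ he₂₂ he₃₁ he₃₂ hconn₁
    hconn₂ hv₁ hv₂
  refine crossA'so_nonneg_of_crossC hp o a₁ a₂ v b hC ?_
  -- the measures
  have hq₀₀₀ : IsProbVec (Function.update (Function.update (Function.update p e₁ 0) e₂ 0) e₃ 0) :=
    ((hp.update e₁ le_rfl zero_le_one).update e₂ le_rfl zero_le_one).update e₃ le_rfl zero_le_one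
  have hq₀₁₁ : IsProbVec (Function.update (Function.update (Function.update p e₁ 0) e₂ 1) e₃ 1) :=
    ((hp.update e₁ le_rfl zero_le_one).update e₂ zero_le_one le_rfl).update e₃ zero_le_one le_rfl
  -- the events
  set Q := avoidAll ends a₂ {a₁} with hQ
  set Qv := avoidAll ends a₂ (insert a₁ {v}) with hQv
  set oH := connEvent ends a₂ o
  set bH := connEvent ends a₂ b
  set vH := connEvent ends a₂ v
  set L := connEvent ends a₁ v
  -- products under the core measure
  have hP₁' := prod_update_three p (0 : R) 0 0 he₁₁ he₂₁ he₃₁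
  have hP₂' := prod_update_three p (0 : R) 0 0 he₁₂ he₂₂ he₃₂
  -- the two-route theorem and the route-mass facts for the core measure
  have htwo := crossC_nonneg_of_twoRoutes_supp _ hq₀₀₀ hπ₁ hπ₂ hconn₁ hconn₂ hv₁ hv₂ ho hb hroute
    hτ₁ hτ₂ htail₁ htail₂ hsep₁ hsep₂
  rw [hP₁', hP₂'] at htwo
  have hDv0 := prob_Dv_eq_zero_supp _ hconn₁ hconn₂ ho hb hroute
  have hxv0 := prob_xv_le_supp _ hq₀₀₀ hπ₂ hconn₁ hconn₂ ho hv₂ hroute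
  have hyv0 := prob_yv_le_supp _ hq₀₀₀ hπ₁ hconn₁ hconn₂ hb hv₁ hroute
  rw [hP₂'] at hxv0
  rw [hP₁'] at hyv0
  have hxveq := prob_xv_eq_supp _ hπ₂ hconn₁ hconn₂ ho hroute
  have hyveq := prob_yv_eq_supp _ hπ₁ hconn₁ hconn₂ hb hroute
  rw [hP₂'] at hxveq
  rw [hP₁'] at hyveq
  have eu : Q ∩ oH ∩ vHᶜ = Qv ∩ oH := by rw [hQv, avoidAll_pair_eq, Set.inter_right_comm]
  have ew : Q ∩ bH ∩ vHᶜ = Qv ∩ bH := by rw [hQv, avoidAll_pair_eq, Set.inter_right_comm]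
  rw [eu] at hxv0
  rw [ew] at hyv0
  -- the flips and the null measures
  obtain ⟨f₁, f₂, f₃, f₄, f₅, f₆⟩ := flipInv_masses (ends := ends) (o := o) (v := v) (b := b)
    hza₁ hza₂ hzo hzb hzv
  have hflip : ∀ X : Set (Config E),
      (∀ (e : E) (t : V), ends e = s(t, z) → ∀ ω : Config E,
        (∀ e', z ∈ ends e' → ω e' = false) → (Function.update ω e true ∈ X ↔ ω ∈ X)) →
      prob (Function.update (Function.update (Function.update p e₁ 1) e₂ 0) e₃ 0) X =
          prob (Function.update (Function.update (Function.update p e₁ 0) e₂ 0) e₃ 0) X ∧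
        prob (Function.update (Function.update (Function.update p e₁ 0) e₂ 1) e₃ 0) X =
          prob (Function.update (Function.update (Function.update p e₁ 0) e₂ 0) e₃ 0) X ∧
        prob (Function.update (Function.update (Function.update p e₁ 0) e₂ 0) e₃ 1) X =
          prob (Function.update (Function.update (Function.update p e₁ 0) e₂ 0) e₃ 0) X :=
    fun X hX => ⟨prob_flip₁ p h₁ hz h₁₂ h₁₃ h₂₃ hX, prob_flip₂ p h₂ hz h₁₂ h₁₃ h₂₃ hX,
      prob_flip₃ p h₃ hz h₁₂ h₂₃ hX⟩
  have hsure : ∀ X : Set (Config E), X ⊆ Q →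
      prob (Function.update (Function.update (Function.update p e₁ 1) e₂ 1) e₃ 1) X = 0 ∧
        prob (Function.update (Function.update (Function.update p e₁ 1) e₂ 0) e₃ 1) X = 0 := by
    intro X hX
    refine ⟨prob_eq_zero_of_sure_path _ h₁ h₃ ?_ ?_ hX, prob_eq_zero_of_sure_path _ h₁ h₃ ?_ ?_ hX⟩
    · rw [Function.update_of_ne h₁₃, Function.update_of_ne h₁₂]; simp
    · simp
    · rw [Function.update_of_ne h₁₃, Function.update_of_ne h₁₂]; simp
    · simp
  have hglued : ∀ A : Set (Config E),
      prob (Function.update (Function.update (Function.update p e₁ 0) e₂ 1) e₃ 1) (Q ∩ (L ∩ A)) = 0 := by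
    intro A
    refine prob_QL_eq_zero_of_sure_vpath _ h₂ h₃ ?_ ?_ A
    · rw [Function.update_of_ne h₂₃]; simp
    · simp
  -- the `(1,1,0)` law
  have hvbar := fun 𝓤 => prob_sure_path_eq (ends := ends) p h₁ h₂ hza₂ hz h₁₂ h₁₃ h₂₃ 𝓤
  have co : oH = clusterInEvent ends a₂ {A : Set V | o ∈ A} := connEvent_eq_clusterInEvent_mem a₂ o
  have cb : bH = clusterInEvent ends a₂ {A : Set V | b ∈ A} := connEvent_eq_clusterInEvent_mem a₂ b
  have cob : oH ∩ bH = clusterInEvent ends a₂ ({A : Set V | o ∈ A} ∩ {A : Set V | b ∈ A}) :=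
    connEvent_inter_eq_clusterInEvent_mem a₂ o b
  have cuniv : clusterInEvent ends a₂ (Set.univ : Set (Set V)) = Set.univ := by
    ext ω; simp [clusterInEvent]
  -- the six masses of `p`
  set a := p e₁ with ha
  set ζ := p e₂ with hζ
  set r := p e₃ with hr
  set A := a * (1 - ζ) * (1 - r) + (1 - a) * ζ * (1 - r) + (1 - a) * (1 - ζ) * r +
    (1 - a) * (1 - ζ) * (1 - r) with hA
  set G := (1 - a) * ζ * r with hG
  set B := a * ζ * (1 - r) with hB
  have hZ : prob p Q = A * prob (Function.update (Function.update (Function.update p e₁ 0) e₂ 0) e₃ 0) Q +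
      G * prob (Function.update (Function.update (Function.update p e₁ 0) e₂ 1) e₃ 1) Q +
      B * prob (Function.update (Function.update (Function.update p e₁ 0) e₂ 0) e₃ 0) Qv := by
    have h110 : prob (Function.update (Function.update (Function.update p e₁ 1) e₂ 1) e₃ 0) Q =
        prob (Function.update (Function.update (Function.update p e₁ 0) e₂ 0) e₃ 0) Qv := by
      have := (hvbar Set.univ).2
      rwa [cuniv, Set.inter_univ, Set.inter_univ] at this
    rw [prob_pin_three p Q h₁₂ h₁₃ h₂₃, (hsure Q subset_rfl).1, (hsure Q subset_rfl).2,
      (hflip Q f₁).1, (hflip Q f₁).2.1, (hflip Q f₁).2.2, h110]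
    ring
  have hx : prob p (Q ∩ oH) =
      A * prob (Function.update (Function.update (Function.update p e₁ 0) e₂ 0) e₃ 0) (Q ∩ oH) +
      G * prob (Function.update (Function.update (Function.update p e₁ 0) e₂ 1) e₃ 1) (Q ∩ oH) +
      B * prob (Function.update (Function.update (Function.update p e₁ 0) e₂ 0) e₃ 0) (Qv ∩ oH) := by
    have h110 : prob (Function.update (Function.update (Function.update p e₁ 1) e₂ 1) e₃ 0) (Q ∩ oH) =
        prob (Function.update (Function.update (Function.update p e₁ 0) e₂ 0) e₃ 0) (Qv ∩ oH) := by
      have := (hvbar {A : Set V | o ∈ A}).2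
      rwa [← co] at this
    rw [prob_pin_three p _ h₁₂ h₁₃ h₂₃, (hsure _ Set.inter_subset_left).1,
      (hsure _ Set.inter_subset_left).2, (hflip _ f₂).1, (hflip _ f₂).2.1, (hflip _ f₂).2.2, h110]
    ring
  have hy : prob p (Q ∩ bH) =
      A * prob (Function.update (Function.update (Function.update p e₁ 0) e₂ 0) e₃ 0) (Q ∩ bH) +
      G * prob (Function.update (Function.update (Function.update p e₁ 0) e₂ 1) e₃ 1) (Q ∩ bH) +
      B * prob (Function.update (Function.update (Function.update p e₁ 0) e₂ 0) e₃ 0) (Qv ∩ bH) := by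
    have h110 : prob (Function.update (Function.update (Function.update p e₁ 1) e₂ 1) e₃ 0) (Q ∩ bH) =
        prob (Function.update (Function.update (Function.update p e₁ 0) e₂ 0) e₃ 0) (Qv ∩ bH) := by
      have := (hvbar {A : Set V | b ∈ A}).2
      rwa [← cb] at this
    rw [prob_pin_three p _ h₁₂ h₁₃ h₂₃, (hsure _ Set.inter_subset_left).1,
      (hsure _ Set.inter_subset_left).2, (hflip _ f₃).1, (hflip _ f₃).2.1, (hflip _ f₃).2.2, h110]
    ring
  have hxv : prob p (Q ∩ (L ∩ oH)) =
      A * prob (Function.update (Function.update (Function.update p e₁ 0) e₂ 0) e₃ 0) (Q ∩ (L ∩ oH)) +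
      B * prob (Function.update (Function.update (Function.update p e₁ 0) e₂ 0) e₃ 0) (Qv ∩ oH) := by
    have h110 : prob (Function.update (Function.update (Function.update p e₁ 1) e₂ 1) e₃ 0) (Q ∩ (L ∩ oH)) =
        prob (Function.update (Function.update (Function.update p e₁ 0) e₂ 0) e₃ 0) (Qv ∩ oH) := by
      have := (hvbar {A : Set V | o ∈ A}).1
      rwa [← co] at this
    rw [prob_pin_three p _ h₁₂ h₁₃ h₂₃, (hsure _ Set.inter_subset_left).1,
      (hsure _ Set.inter_subset_left).2, (hflip _ f₄).1, (hflip _ f₄).2.1, (hflip _ f₄).2.2, h110,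
      hglued oH]
    ring
  have hyv : prob p (Q ∩ (L ∩ bH)) =
      A * prob (Function.update (Function.update (Function.update p e₁ 0) e₂ 0) e₃ 0) (Q ∩ (L ∩ bH)) +
      B * prob (Function.update (Function.update (Function.update p e₁ 0) e₂ 0) e₃ 0) (Qv ∩ bH) := by
    have h110 : prob (Function.update (Function.update (Function.update p e₁ 1) e₂ 1) e₃ 0) (Q ∩ (L ∩ bH)) =
        prob (Function.update (Function.update (Function.update p e₁ 0) e₂ 0) e₃ 0) (Qv ∩ bH) := by
      have := (hvbar {A : Set V | b ∈ A}).1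
      rwa [← cb] at this
    rw [prob_pin_three p _ h₁₂ h₁₃ h₂₃, (hsure _ Set.inter_subset_left).1,
      (hsure _ Set.inter_subset_left).2, (hflip _ f₅).1, (hflip _ f₅).2.1, (hflip _ f₅).2.2, h110,
      hglued bH]
    ring
  have hDv : prob p (Q ∩ (L ∩ (oH ∩ bH))) =
      B * prob (Function.update (Function.update (Function.update p e₁ 0) e₂ 0) e₃ 0) (Qv ∩ (oH ∩ bH)) := by
    have h110 : prob (Function.update (Function.update (Function.update p e₁ 1) e₂ 1) e₃ 0)
        (Q ∩ (L ∩ (oH ∩ bH))) =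
        prob (Function.update (Function.update (Function.update p e₁ 0) e₂ 0) e₃ 0) (Qv ∩ (oH ∩ bH)) := by
      have := (hvbar ({A : Set V | o ∈ A} ∩ {A : Set V | b ∈ A})).1
      rwa [← cob] at this
    rw [prob_pin_three p _ h₁₂ h₁₃ h₂₃, (hsure _ Set.inter_subset_left).1,
      (hsure _ Set.inter_subset_left).2, (hflip _ f₆).1, (hflip _ f₆).2.1, (hflip _ f₆).2.2, h110,
      hglued (oH ∩ bH), hDv0]
    ring
  -- BHK with the avoidance of `{a₁, v}` for the core measure
  have hbhk : prob (Function.update (Function.update (Function.update p e₁ 0) e₂ 0) e₃ 0) (Qv ∩ oH) *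
      prob (Function.update (Function.update (Function.update p e₁ 0) e₂ 0) e₃ 0) (Qv ∩ bH) ≤
      prob (Function.update (Function.update (Function.update p e₁ 0) e₂ 0) e₃ 0) (Qv ∩ (oH ∩ bH)) *
      prob (Function.update (Function.update (Function.update p e₁ 0) e₂ 0) e₃ 0) Qv := by
    have key := bhk_same_cluster_events_avoid _ hq₀₀₀ ends a₂ (insert a₁ {v})
      (isUpperSet_mem_set (V := V) o) (isUpperSet_mem_set (V := V) b)
    rw [← connEvent_eq_clusterInEvent_mem, ← connEvent_eq_clusterInEvent_mem,
      ← connEvent_inter_eq_clusterInEvent_mem, Set.inter_comm (connEvent ends a₂ o),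
      Set.inter_comm (connEvent ends a₂ b), Set.inter_comm (connEvent ends a₂ o ∩ _)] at key
    exact key
  -- monotonicity facts
  have hs : prob (Function.update (Function.update (Function.update p e₁ 0) e₂ 0) e₃ 0) Qv ≤
      prob (Function.update (Function.update (Function.update p e₁ 0) e₂ 0) e₃ 0) Q := by
    refine prob_mono hq₀₀₀ fun ω h x hx => ?_
    rw [Finset.mem_singleton] at hx
    rw [hx]
    exact h a₁ (Finset.mem_insert_self a₁ {v})
  have hu : prob (Function.update (Function.update (Function.update p e₁ 0) e₂ 0) e₃ 0) (Qv ∩ oH) ≤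
      prob (Function.update (Function.update (Function.update p e₁ 0) e₂ 0) e₃ 0) (Q ∩ oH) := by
    refine prob_mono hq₀₀₀ fun ω h => ⟨fun x hx => ?_, h.2⟩
    rw [Finset.mem_singleton] at hx
    rw [hx]
    exact h.1 a₁ (Finset.mem_insert_self a₁ {v})
  have hw : prob (Function.update (Function.update (Function.update p e₁ 0) e₂ 0) e₃ 0) (Qv ∩ bH) ≤
      prob (Function.update (Function.update (Function.update p e₁ 0) e₂ 0) e₃ 0) (Q ∩ bH) := by
    refine prob_mono hq₀₀₀ fun ω h => ⟨fun x hx => ?_, h.2⟩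
    rw [Finset.mem_singleton] at hx
    rw [hx]
    exact h.1 a₁ (Finset.mem_insert_self a₁ {v})
  -- route masses below `π̃ · x`
  have hP₁0 : 0 ≤ ∏ e ∈ π₁, p e := Finset.prod_nonneg fun e _ => hp.nonneg e
  have hP₂0 : 0 ≤ ∏ e ∈ π₂, p e := Finset.prod_nonneg fun e _ => hp.nonneg e
  have hP₁1 : ∏ e ∈ π₁, p e ≤ 1 := Finset.prod_le_one (fun e _ => hp.nonneg e) (fun e _ => hp.le_one e)
  have hP₂1 : ∏ e ∈ π₂, p e ≤ 1 := Finset.prod_le_one (fun e _ => hp.nonneg e) (fun e _ => hp.le_one e)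
  have hxvπ : prob (Function.update (Function.update (Function.update p e₁ 0) e₂ 0) e₃ 0) (Q ∩ (L ∩ oH)) ≤
      (∏ e ∈ π₁, p e + ∏ e ∈ π₂, p e - (∏ e ∈ π₁, p e) * ∏ e ∈ π₂, p e) *
        prob (Function.update (Function.update (Function.update p e₁ 0) e₂ 0) e₃ 0) (Q ∩ oH) := by
    rw [hxveq]
    have h1 : prob (Function.update (Function.update (Function.update p e₁ 0) e₂ 0) e₃ 0)
        (avoidAll ends a₂ (insert a₁ V₂) ∩ oH) ≤
        prob (Function.update (Function.update (Function.update p e₁ 0) e₂ 0) e₃ 0) (Q ∩ oH) := by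
      refine prob_mono hq₀₀₀ fun ω hω => ⟨fun x hx => ?_, hω.2⟩
      rw [Finset.mem_singleton] at hx
      rw [hx]
      exact hω.1 a₁ (Finset.mem_insert_self a₁ V₂)
    have h2 : ∏ e ∈ π₂, p e ≤ ∏ e ∈ π₁, p e + ∏ e ∈ π₂, p e - (∏ e ∈ π₁, p e) * ∏ e ∈ π₂, p e := by
      have := mul_nonneg hP₁0 (sub_nonneg.2 hP₂1)
      linarith
    calc (∏ e ∈ π₂, p e) * _ ≤ (∏ e ∈ π₂, p e) *
          prob (Function.update (Function.update (Function.update p e₁ 0) e₂ 0) e₃ 0) (Q ∩ oH) :=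
          mul_le_mul_of_nonneg_left h1 hP₂0
      _ ≤ _ := mul_le_mul_of_nonneg_right h2 (prob_nonneg hq₀₀₀ _)
  have hyvπ : prob (Function.update (Function.update (Function.update p e₁ 0) e₂ 0) e₃ 0) (Q ∩ (L ∩ bH)) ≤
      (∏ e ∈ π₁, p e + ∏ e ∈ π₂, p e - (∏ e ∈ π₁, p e) * ∏ e ∈ π₂, p e) *
        prob (Function.update (Function.update (Function.update p e₁ 0) e₂ 0) e₃ 0) (Q ∩ bH) := by
    rw [hyveq]
    have h1 : prob (Function.update (Function.update (Function.update p e₁ 0) e₂ 0) e₃ 0)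
        (avoidAll ends a₂ (insert a₁ V₁) ∩ bH) ≤
        prob (Function.update (Function.update (Function.update p e₁ 0) e₂ 0) e₃ 0) (Q ∩ bH) := by
      refine prob_mono hq₀₀₀ fun ω hω => ⟨fun x hx => ?_, hω.2⟩
      rw [Finset.mem_singleton] at hx
      rw [hx]
      exact hω.1 a₁ (Finset.mem_insert_self a₁ V₁)
    have h2 : ∏ e ∈ π₁, p e ≤ ∏ e ∈ π₁, p e + ∏ e ∈ π₂, p e - (∏ e ∈ π₁, p e) * ∏ e ∈ π₂, p e := by
      have := mul_nonneg hP₂0 (sub_nonneg.2 hP₁1)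
      linarith
    calc (∏ e ∈ π₁, p e) * _ ≤ (∏ e ∈ π₁, p e) *
          prob (Function.update (Function.update (Function.update p e₁ 0) e₂ 0) e₃ 0) (Q ∩ bH) :=
          mul_le_mul_of_nonneg_left h1 hP₁0
      _ ≤ _ := mul_le_mul_of_nonneg_right h2 (prob_nonneg hq₀₀₀ _)
  -- the weights
  have ha0 : 0 ≤ a := hp.nonneg e₁
  have ha1 : a ≤ 1 := hp.le_one e₁
  have hζ0 : 0 ≤ ζ := hp.nonneg e₂
  have hζ1 : ζ ≤ 1 := hp.le_one e₂
  have hr0 : 0 ≤ r := hp.nonneg e₃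
  have hr1 : r ≤ 1 := hp.le_one e₃
  have hA0 : 0 ≤ A := by
    rw [hA]
    have := mul_nonneg (mul_nonneg ha0 (sub_nonneg.2 hζ1)) (sub_nonneg.2 hr1)
    have := mul_nonneg (mul_nonneg (sub_nonneg.2 ha1) hζ0) (sub_nonneg.2 hr1)
    have := mul_nonneg (mul_nonneg (sub_nonneg.2 ha1) (sub_nonneg.2 hζ1)) hr0
    have := mul_nonneg (mul_nonneg (sub_nonneg.2 ha1) (sub_nonneg.2 hζ1)) (sub_nonneg.2 hr1)
    linarith
  have hG0 : 0 ≤ G := mul_nonneg (mul_nonneg (sub_nonneg.2 ha1) hζ0) hr0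
  have hB0 : 0 ≤ B := mul_nonneg (mul_nonneg ha0 hζ0) (sub_nonneg.2 hr1)
  set pit := ∏ e ∈ π₁, p e + ∏ e ∈ π₂, p e - (∏ e ∈ π₁, p e) * ∏ e ∈ π₂, p e with hpit
  have hpit0 : 0 ≤ pit := by
    rw [hpit]
    have := mul_nonneg hP₂0 (sub_nonneg.2 hP₁1)
    linarith
  have hpit1 : pit ≤ 1 := by
    rw [hpit]
    have := mul_nonneg (sub_nonneg.2 hP₁1) (sub_nonneg.2 hP₂1)
    linarith
  have hweight : (1 - (pit + a * ζ * (1 - pit))) * B ≤ ((pit + a * ζ * (1 - pit)) - pit) * A := by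
    have key := blob_weight_condition (R := R) ha0 ha1 hζ0 hζ1 hr0 hpit1
    have eA : (1 - ζ) * (1 - a * r) + (1 - a) * ζ * (1 - r) = A := by rw [hA]; ring
    rw [eA] at key
    rw [hB]
    exact key
  have hCpit : pit ≤ pit + a * ζ * (1 - pit) := by
    have := mul_nonneg (mul_nonneg ha0 hζ0) (sub_nonneg.2 hpit1)
    linarith
  have hC1 : pit + a * ζ * (1 - pit) ≤ 1 := by
    have h1 : a * ζ ≤ 1 := by
      have := mul_le_mul ha1 hζ1 hζ0 zero_le_one
      linarith
    have h2 : 0 ≤ 1 - pit := by linarith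
    have := mul_nonneg h2 (sub_nonneg.2 h1)
    linarith
  -- the two-route crux of the core in the mixture lemma's form
  have htwo' : 0 ≤ -prob (Function.update (Function.update (Function.update p e₁ 0) e₂ 0) e₃ 0) (Q ∩ bH) *
        prob (Function.update (Function.update (Function.update p e₁ 0) e₂ 0) e₃ 0) (Q ∩ (L ∩ oH)) -
      prob (Function.update (Function.update (Function.update p e₁ 0) e₂ 0) e₃ 0) (Q ∩ oH) *
        prob (Function.update (Function.update (Function.update p e₁ 0) e₂ 0) e₃ 0) (Q ∩ (L ∩ bH)) +
      pit * prob (Function.update (Function.update (Function.update p e₁ 0) e₂ 0) e₃ 0) (Q ∩ oH) *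
        prob (Function.update (Function.update (Function.update p e₁ 0) e₂ 0) e₃ 0) (Q ∩ bH) := by
    unfold crossC at htwo
    rw [hDv0] at htwo
    linarith
  -- assemble
  have hmix := mixture_nonneg hA0 hG0 hB0 hP₁0 hP₁1 hP₂0 hP₂1 hCpit hC1 hweight hs
    (prob_nonneg hq₀₀₀ (Qv ∩ oH)) (prob_nonneg hq₀₀₀ (Qv ∩ bH))
    (prob_nonneg hq₀₀₀ (Qv ∩ (oH ∩ bH))) hu hw hxv0 hyv0 hxvπ hyvπ hbhk htwo'
    (prob_nonneg hq₀₁₁ Q) (prob_nonneg hq₀₁₁ (Q ∩ oH)) (prob_nonneg hq₀₁₁ (Q ∩ bH))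
  unfold crossC
  rw [hZ, hx, hy, hxv, hyv, hDv]
  linarith [hmix]

end Main

end CrossAPrimeThreeRoutesBlob

end Summit.Ventures.PercRepro2
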